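import Summits.Ventures.PackingBounds.Energy.DiploSimplexAntipodal

/-!
# The diplo-simplex maximises the product of distances among antipodal configurations (logarithmic energy, all `n ≥ 3`)

Framing: lottery ticket; floor = certified bounds/negative ranges. Venture `PackingBounds` (cell `pub-packcert`, seat
`pub-packcert-energy`, gen 26) — the `s → 0` companion of `DiploSimplexAntipodalUniversal` / `…Rigid`.

For the logarithmic potential `a(t) = -½ log(2 - 2t) = -log ‖x - y‖` the even part is EXPLICIT:
`a(t) + a(-t) = -½ log(4 - 4t²)`, a strictly convex function of `u = t²` with supporting slope `m = 1/(2(1 - 1/n²))` at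
`u₀ = 1/n²`; the supporting (and strict) inequality is `log x ≤ x - 1` (`<` for `x ≠ 1`) at `x = (1 - t²)/(1 - 1/n²)`.
Hence (`DiploSimplexAntipodal.energy_ge`, `nodeset_of_energy_le`):
**Theorem (`log_energy_le`, `log_nodeset_of_energy_ge`, `log_maximisers_isometric`).** For `n ≥ 3`, every antipodal
configuration `C` of `2n+2` unit vectors of `ℝⁿ` has `Σ_{x ≠ y} log ‖x - y‖ ≤ (n+1)(log 4 + n log(4 - 4/n²))`, the value of
the diplo-simplex (i.e. `Π_{x ≠ y} ‖x - y‖ ≤ (4 (4 - 4/n²)^n)^{n+1}`), with equality only for node-set configurations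
`{-1, ±1/n}`, all isometric to the diplo-simplex (`Config.DiploSimplexUnique`). (Projective LP bound of degree one;
Cohn–Kumar 2007 §8.)

## References
* H. Cohn, A. Kumar, J. Amer. Math. Soc. 20 (2007) 99–148, §8. [`CohnKumar2006`]
* B. Ballinger et al., Experiment. Math. 18 (2009) 257–283, §3.4. [`BallingerEtAl2009`]
-/

noncomputable section

open Finset
open scoped RealInnerProductSpace

namespace Summit.Ventures.PackingBounds.Energy.DiploSimplexAntipodal

variable {n : ℕ}

/-- The even part of the logarithmic potential: `-½log(2-2t) - ½log(2+2t) = -½ log(4 - 4t²)` on `(-1,1)`. [folklore] -/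
theorem log_even_part {t : ℝ} (h1 : -1 < t) (h2 : t < 1) :
    -(1 / 2) * Real.log (2 - 2 * t) + -(1 / 2) * Real.log (2 - 2 * -t) = -(1 / 2) * Real.log (4 - 4 * t ^ 2) := by
  have ha : 0 < 2 - 2 * t := by linarith
  have hb : 0 < 2 - 2 * -t := by linarith
  have : (4 : ℝ) - 4 * t ^ 2 = (2 - 2 * t) * (2 - 2 * -t) := by ring
  rw [this, Real.log_mul ha.ne' hb.ne']
  ring

/-- Supporting line of `-½ log(4 - 4t²)` (as a function of `t²`) at `1/n²`, from `log x ≤ x - 1`; strict off `t² = 1/n²`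
(`n ≥ 2`, `-1 < t < 1`). [folklore] -/
theorem log_supporting (hn : 2 ≤ n) {t : ℝ} (h1 : -1 < t) (h2 : t < 1) :
    (-(1 / 2) * Real.log (4 - 4 * (1 / (n : ℝ) ^ 2)) + 1 / (2 * (1 - 1 / (n : ℝ) ^ 2)) * (t ^ 2 - 1 / (n : ℝ) ^ 2) ≤
      -(1 / 2) * Real.log (4 - 4 * t ^ 2)) ∧
    (t ^ 2 ≠ 1 / (n : ℝ) ^ 2 →
      -(1 / 2) * Real.log (4 - 4 * (1 / (n : ℝ) ^ 2)) + 1 / (2 * (1 - 1 / (n : ℝ) ^ 2)) * (t ^ 2 - 1 / (n : ℝ) ^ 2) <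
        -(1 / 2) * Real.log (4 - 4 * t ^ 2)) := by
  have hn2 : (2 : ℝ) ≤ n := by exact_mod_cast hn
  have hnpos : (0 : ℝ) < n := by linarith
  have hD : 0 < 1 - 1 / (n : ℝ) ^ 2 := by
    have : 1 / (n : ℝ) ^ 2 < 1 := by rw [div_lt_one (by positivity)]; nlinarith
    linarith
  have hT : 0 < 1 - t ^ 2 := by nlinarith
  have hx : 0 < (1 - t ^ 2) / (1 - 1 / (n : ℝ) ^ 2) := div_pos hT hD
  have h4t : (4 : ℝ) - 4 * t ^ 2 = 4 * (1 - t ^ 2) := by ring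
  have h4n : (4 : ℝ) - 4 * (1 / (n : ℝ) ^ 2) = 4 * (1 - 1 / (n : ℝ) ^ 2) := by ring
  have hlog : Real.log (4 - 4 * t ^ 2) - Real.log (4 - 4 * (1 / (n : ℝ) ^ 2)) =
      Real.log ((1 - t ^ 2) / (1 - 1 / (n : ℝ) ^ 2)) := by
    rw [h4t, h4n, Real.log_mul (by norm_num) hT.ne', Real.log_mul (by norm_num) hD.ne', Real.log_div hT.ne' hD.ne']
    ring
  have hxm1 : (1 - t ^ 2) / (1 - 1 / (n : ℝ) ^ 2) - 1 = -(t ^ 2 - 1 / (n : ℝ) ^ 2) / (1 - 1 / (n : ℝ) ^ 2) := by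
    rw [div_sub_one hD.ne']
    ring
  have e : 1 / (2 * (1 - 1 / (n : ℝ) ^ 2)) * (t ^ 2 - 1 / (n : ℝ) ^ 2) =
      -(1 / 2) * (-(t ^ 2 - 1 / (n : ℝ) ^ 2) / (1 - 1 / (n : ℝ) ^ 2)) := by
    generalize (1 - 1 / (n : ℝ) ^ 2) = D
    generalize (t ^ 2 - 1 / (n : ℝ) ^ 2) = X
    ring
  constructor
  · have hL := Real.log_le_sub_one_of_pos hx
    rw [hxm1] at hL
    rw [e]
    linarith [hlog]
  · intro hne
    have hx1 : (1 - t ^ 2) / (1 - 1 / (n : ℝ) ^ 2) ≠ 1 := by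
      intro h
      rw [div_eq_one_iff_eq hD.ne'] at h
      exact hne (by linarith)
    have hL := Real.log_lt_sub_one_of_pos hx hx1
    rw [hxm1] at hL
    rw [e]
    linarith [hlog]

/-- `Σ_{x ≠ y} -½ log(2 - 2⟪x,y⟫) = -Σ_{x ≠ y} log ‖x - y‖` for unit vectors. -/
private theorem halflog_sum_eq (C : Finset (EuclideanSpace ℝ (Fin n))) (h1 : ∀ x ∈ C, ‖x‖ = 1) :
    ∑ x ∈ C, ∑ y ∈ C.erase x, -(1 / 2) * Real.log (2 - 2 * inner ℝ x y) =
      -∑ x ∈ C, ∑ y ∈ C.erase x, Real.log ‖x - y‖ := by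
  rw [← sum_neg_distrib]
  refine sum_congr rfl fun x hx => ?_
  rw [← sum_neg_distrib]
  refine sum_congr rfl fun y hy => ?_
  have hsq : ‖x - y‖ ^ 2 = 2 - 2 * inner ℝ x y := by
    rw [norm_sub_sq_real, h1 x hx, h1 y (mem_of_mem_erase hy)]; ring
  have hnn : 0 ≤ 2 - 2 * inner ℝ x y := by rw [← hsq]; positivity
  rw [Config.DiploSimplex.norm_sub_eq_sqrt (h1 x hx) (h1 y (mem_of_mem_erase hy)), Real.log_sqrt hnn]
  ring

/-- The diplo value of `-½ log(2-2t)` is `-(n+1)(log 4 + n log(4 - 4/n²))` (`n ≥ 3`). -/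
private theorem halflog_value (hn : 3 ≤ n) :
    (2 * n + 2 : ℝ) * (-(1 / 2) * Real.log (2 - 2 * (-1)) + n * (-(1 / 2) * Real.log (2 - 2 * (-1 / (n : ℝ)))) +
        n * (-(1 / 2) * Real.log (2 - 2 * (1 / (n : ℝ))))) =
      -(((n : ℝ) + 1) * (Real.log 4 + n * Real.log (4 - 4 / (n : ℝ) ^ 2))) := by
  have hn3 : (3 : ℝ) ≤ n := by exact_mod_cast hn
  have hnpos : (0 : ℝ) < n := by linarith
  have hin0 : 0 < 1 / (n : ℝ) := by positivity
  have hin1 : 1 / (n : ℝ) < 1 := by rw [div_lt_one hnpos]; linarith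
  have ha : 0 < 2 - 2 * (-1 / (n : ℝ)) := by rw [neg_div]; linarith
  have hb : 0 < 2 - 2 * (1 / (n : ℝ)) := by linarith
  have e1 : (2 : ℝ) - 2 * (-1) = 4 := by norm_num
  have e2 : Real.log (2 - 2 * (-1 / (n : ℝ))) + Real.log (2 - 2 * (1 / (n : ℝ))) = Real.log (4 - 4 / (n : ℝ) ^ 2) := by
    rw [← Real.log_mul ha.ne' hb.ne']
    congr 1
    field_simp
    ring
  rw [e1, ← e2]
  ring

/-- The supporting-line hypotheses of `energy_ge` / `nodeset_of_energy_le` for `-½ log(2-2t)` (`n ≥ 3`). -/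
private theorem halflog_supp (hn : 3 ≤ n) :
    (∀ t : ℝ, -1 < t → t < 1 →
      (fun t => -(1 / 2) * Real.log (2 - 2 * t)) (1 / (n : ℝ)) + (fun t => -(1 / 2) * Real.log (2 - 2 * t)) (-1 / (n : ℝ)) +
          1 / (2 * (1 - 1 / (n : ℝ) ^ 2)) * (t ^ 2 - 1 / (n : ℝ) ^ 2) ≤
        (fun t => -(1 / 2) * Real.log (2 - 2 * t)) t + (fun t => -(1 / 2) * Real.log (2 - 2 * t)) (-t)) ∧
    (∀ t : ℝ, -1 < t → t < 1 → t ^ 2 ≠ 1 / (n : ℝ) ^ 2 →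
      (fun t => -(1 / 2) * Real.log (2 - 2 * t)) (1 / (n : ℝ)) + (fun t => -(1 / 2) * Real.log (2 - 2 * t)) (-1 / (n : ℝ)) +
          1 / (2 * (1 - 1 / (n : ℝ) ^ 2)) * (t ^ 2 - 1 / (n : ℝ) ^ 2) <
        (fun t => -(1 / 2) * Real.log (2 - 2 * t)) t + (fun t => -(1 / 2) * Real.log (2 - 2 * t)) (-t)) := by
  have hn3 : (3 : ℝ) ≤ n := by exact_mod_cast hn
  have hnpos : (0 : ℝ) < n := by linarith
  have hin0 : 0 < 1 / (n : ℝ) := by positivity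
  have hin1 : 1 / (n : ℝ) < 1 := by rw [div_lt_one hnpos]; linarith
  have hsq : (1 / (n : ℝ)) ^ 2 = 1 / (n : ℝ) ^ 2 := by rw [div_pow, one_pow]
  have hnode : -(1 / 2) * Real.log (2 - 2 * (1 / (n : ℝ))) + -(1 / 2) * Real.log (2 - 2 * (-1 / (n : ℝ))) =
      -(1 / 2) * Real.log (4 - 4 * (1 / (n : ℝ) ^ 2)) := by
    rw [neg_div, ← hsq]; exact log_even_part (by linarith) hin1
  refine ⟨fun t ht1 ht2 => ?_, fun t ht1 ht2 hne => ?_⟩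
  · show -(1 / 2) * Real.log (2 - 2 * (1 / (n : ℝ))) + -(1 / 2) * Real.log (2 - 2 * (-1 / (n : ℝ))) +
        1 / (2 * (1 - 1 / (n : ℝ) ^ 2)) * (t ^ 2 - 1 / (n : ℝ) ^ 2) ≤
      -(1 / 2) * Real.log (2 - 2 * t) + -(1 / 2) * Real.log (2 - 2 * -t)
    rw [hnode, log_even_part ht1 ht2]
    exact (log_supporting (by omega) ht1 ht2).1
  · show -(1 / 2) * Real.log (2 - 2 * (1 / (n : ℝ))) + -(1 / 2) * Real.log (2 - 2 * (-1 / (n : ℝ))) +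
        1 / (2 * (1 - 1 / (n : ℝ) ^ 2)) * (t ^ 2 - 1 / (n : ℝ) ^ 2) <
      -(1 / 2) * Real.log (2 - 2 * t) + -(1 / 2) * Real.log (2 - 2 * -t)
    rw [hnode, log_even_part ht1 ht2]
    exact (log_supporting (by omega) ht1 ht2).2 hne

/-- The slope `1/(2(1 - 1/n²))` is non-negative (`n ≥ 3`). -/
private theorem halflog_slope_nonneg (hn : 3 ≤ n) : (0 : ℝ) ≤ 1 / (2 * (1 - 1 / (n : ℝ) ^ 2)) := by
  have hn3 : (3 : ℝ) ≤ n := by exact_mod_cast hn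
  have : 1 / (n : ℝ) ^ 2 < 1 := by rw [div_lt_one (by positivity)]; nlinarith
  have : 0 < 1 - 1 / (n : ℝ) ^ 2 := by linarith
  positivity

section Log

variable (hn : 3 ≤ n) (C : Finset (EuclideanSpace ℝ (Fin n))) (h1 : ∀ x ∈ C, ‖x‖ = 1) (hN : C.card = 2 * n + 2)
  (hanti : ∀ x ∈ C, -x ∈ C)
include hn h1 hN hanti

/-- **The diplo-simplex maximises `Σ log ‖x - y‖` (the product of distances) among antipodal `(2n+2)`-configurations of
`S^{n-1}`**, every `n ≥ 3`: `Σ_{x ≠ y} log ‖x - y‖ ≤ (n+1)(log 4 + n log(4 - 4/n²))`. [cite: CohnKumar2006, §8] -/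
theorem log_energy_le :
    ∑ x ∈ C, ∑ y ∈ C.erase x, Real.log ‖x - y‖ ≤ ((n : ℝ) + 1) * (Real.log 4 + n * Real.log (4 - 4 / (n : ℝ) ^ 2)) := by
  classical
  have h := energy_ge hn (fun t => -(1 / 2) * Real.log (2 - 2 * t)) (1 / (2 * (1 - 1 / (n : ℝ) ^ 2))) C h1 hN hanti
    (halflog_slope_nonneg hn) (halflog_supp hn).1
  have h' : (2 * n + 2 : ℝ) * (-(1 / 2) * Real.log (2 - 2 * (-1)) + n * (-(1 / 2) * Real.log (2 - 2 * (-1 / (n : ℝ)))) +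
        n * (-(1 / 2) * Real.log (2 - 2 * (1 / (n : ℝ))))) ≤
      ∑ x ∈ C, ∑ y ∈ C.erase x, -(1 / 2) * Real.log (2 - 2 * inner ℝ x y) := h
  rw [halflog_sum_eq C h1, halflog_value hn] at h'
  linarith

/-- **Rigidity:** an antipodal `(2n+2)`-configuration with `Σ log ‖x - y‖ ≥ (n+1)(log 4 + n log(4 - 4/n²))` has all inner
products in `{-1, -1/n, 1/n}`. [cite: CohnKumar2006, §8] -/
theorem log_nodeset_of_energy_ge
    (hge : ((n : ℝ) + 1) * (Real.log 4 + n * Real.log (4 - 4 / (n : ℝ) ^ 2)) ≤ ∑ x ∈ C, ∑ y ∈ C.erase x, Real.log ‖x - y‖) :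
    ∀ x ∈ C, ∀ y ∈ C, x ≠ y →
      inner ℝ x y = -1 ∨ inner ℝ x y = -1 / (n : ℝ) ∨ inner ℝ x y = 1 / (n : ℝ) := by
  classical
  refine nodeset_of_energy_le hn (fun t => -(1 / 2) * Real.log (2 - 2 * t)) (1 / (2 * (1 - 1 / (n : ℝ) ^ 2))) C h1 hN
    hanti (halflog_slope_nonneg hn) (halflog_supp hn).1 (halflog_supp hn).2 ?_
  show ∑ x ∈ C, ∑ y ∈ C.erase x, -(1 / 2) * Real.log (2 - 2 * inner ℝ x y) ≤
    (2 * n + 2 : ℝ) * (-(1 / 2) * Real.log (2 - 2 * (-1)) + n * (-(1 / 2) * Real.log (2 - 2 * (-1 / (n : ℝ)))) +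
      n * (-(1 / 2) * Real.log (2 - 2 * (1 / (n : ℝ)))))
  rw [halflog_sum_eq C h1, halflog_value hn]
  linarith

/-- **The diplo-simplex is the unique antipodal maximiser of the product of distances** (every `n ≥ 3`): any two antipodal
`(2n+2)`-configurations attaining the bound are isometric. [cite: BallingerEtAl2009, §3.4] -/
theorem log_maximisers_isometric (C' : Finset (EuclideanSpace ℝ (Fin n))) (h1' : ∀ x ∈ C', ‖x‖ = 1)
    (hN' : C'.card = 2 * n + 2) (hanti' : ∀ x ∈ C', -x ∈ C')
    (hge : ((n : ℝ) + 1) * (Real.log 4 + n * Real.log (4 - 4 / (n : ℝ) ^ 2)) ≤ ∑ x ∈ C, ∑ y ∈ C.erase x, Real.log ‖x - y‖)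
    (hge' : ((n : ℝ) + 1) * (Real.log 4 + n * Real.log (4 - 4 / (n : ℝ) ^ 2)) ≤
      ∑ x ∈ C', ∑ y ∈ C'.erase x, Real.log ‖x - y‖) :
    ∃ Ψ : EuclideanSpace ℝ (Fin n) ≃ₗᵢ[ℝ] EuclideanSpace ℝ (Fin n), C' = C.image Ψ :=
  Config.DiploSimplexUnique.isometric_of_nodesets hn C C' h1 hN (log_nodeset_of_energy_ge hn C h1 hN hanti hge)
    h1' hN' (log_nodeset_of_energy_ge hn C' h1' hN' hanti' hge')

end Log

end Summit.Ventures.PackingBounds.Energy.DiploSimplexAntipodal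

end
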